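import Summits.KontsevichZagierPeriods.Zeta5Search.Brown8.XStarOrbitCover

/-!
# BZ's live cone is stable under the symmetry group: the chain condition is automatic

HONEST FRAMING: systematic search; no irrationality claim unless certified.  Nothing in this file is about
irrationality or about `ζ(5)` records; it is integer linear arithmetic about Brown–Zudilin's 8-term cellular family
[BrownZudilin2022, arXiv:2210.03391] in the coordinates typed in `Families/CellularBrownZudilin` /
`Families/CellularEightMiddleWeights` (p248673), plus one corollary that feeds the Literature fact (27)
(`BrownZudilin2022.invariance_of_converges'`, typed PER GENERATOR on common domains of convergence) through it.

## What is proved (fam-brown8 gen 11)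

* `converges_applyGen_of_live`, `liveBZ_applyGen_of_live`: for every one of the five generators `i₁, p₀₁, p₁₂, h, h'`
  of BZ's group `G ≅ S₇` and every integer vector `a` with `Converges a` and `LiveBZ a`, the image `applyGen i a` is again
  convergent AND live.  (For non-live convergent vectors this is false: a generator can destroy convergence, e.g.
  `p₁₂ (1,0,0,0,0,3,0,3)` — found by exact LP, fam-brown8 g11 `lp_liveinv.json`; the kernel proof below is `omega` after unfolding.)
* `live_chain`: hence EVERY word is a convergent chain from a live convergent vector, and its end point is live and convergent —
  the live cone `{Converges ∧ LiveBZ} ∩ ℤ⁸` is a union of `G`-orbits, and on it the hypothesis `ConvergentChain w a` of the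
  covering theorem `xStarOrbitCover_holds` (p298540) holds for every `w`.
* `normalisedIntegral'_invariant_of_live`: granted (27) per generator (`invariance_of_converges'`), the normalised integral
  `I(a)/∏_{i∈F} h_i(a)!` is invariant under the WHOLE group on the live cone — no analytic continuation in the exponents is needed
  there (FAMILY brown8 §2.5 C had flagged the group form of (27) as 'our remark, not a typed fact'; on the live cone it now is one).
* `xStarOrbitCover_live`: the `X*`-representative `applyWord w a` produced by the cover is itself live and convergent.
-/

namespace Summit.KontsevichZagierPeriods.Zeta5Search.Families.Cellular

open Literature.NumberTheory.Irrationality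
open Literature.NumberTheory.Irrationality.BrownZudilin2022
open XStarCover

/-! ### One generator at a time (each is `omega` after unfolding the 17 + 20 rows) -/

/-- Generator `0` preserves convergence on the live cone (linear arithmetic; LP-found, `omega`). -/
theorem converges_gen0_of_live (a : Fin 8 → ℤ) (hc : Converges a) (_hl : LiveBZ a) : Converges (applyGen 0 a) := by
  -- `i₁` preserves convergence outright; liveness is not needed for this generator
  rw [converges_iff] at hc
  simp only [applyGen_0, converges_iff, genI1, Matrix.cons_val]
  omega

/-- Generator `1` preserves convergence on the live cone (linear arithmetic; LP-found, `omega`). -/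
theorem converges_gen1_of_live (a : Fin 8 → ℤ) (hc : Converges a) (hl : LiveBZ a) : Converges (applyGen 1 a) := by
  rw [converges_iff] at hc; rw [liveBZ_iff] at hl
  simp only [applyGen_1, converges_iff, genP01, Matrix.cons_val]
  omega

/-- Generator `2` preserves convergence on the live cone (linear arithmetic; LP-found, `omega`). -/
theorem converges_gen2_of_live (a : Fin 8 → ℤ) (hc : Converges a) (hl : LiveBZ a) : Converges (applyGen 2 a) := by
  rw [converges_iff] at hc; rw [liveBZ_iff] at hl
  simp only [applyGen_2, converges_iff, genP12, Matrix.cons_val]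
  omega

/-- Generator `3` preserves convergence on the live cone (linear arithmetic; LP-found, `omega`). -/
theorem converges_gen3_of_live (a : Fin 8 → ℤ) (hc : Converges a) (hl : LiveBZ a) : Converges (applyGen 3 a) := by
  rw [converges_iff] at hc; rw [liveBZ_iff] at hl
  simp only [applyGen_3, converges_iff, genH, Matrix.cons_val]
  omega

/-- Generator `4` preserves convergence on the live cone (linear arithmetic; LP-found, `omega`). -/
theorem converges_gen4_of_live (a : Fin 8 → ℤ) (hc : Converges a) (hl : LiveBZ a) : Converges (applyGen 4 a) := by
  rw [converges_iff] at hc; rw [liveBZ_iff] at hl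
  simp only [applyGen_4, converges_iff, genH', Matrix.cons_val]
  omega

/-- Generator `0` preserves membership in the live cone `LiveBZ` on the live cone (linear arithmetic; LP-found, `omega`). -/
theorem liveBZ_gen0_of_live (a : Fin 8 → ℤ) (_hc : Converges a) (hl : LiveBZ a) : LiveBZ (applyGen 0 a) := by
  -- `i₁` preserves liveness outright; convergence is not needed for this generator
  rw [liveBZ_iff] at hl
  simp only [applyGen_0, liveBZ_iff, genI1, Matrix.cons_val]
  omega

/-- Generator `1` preserves membership in the live cone `LiveBZ` on the live cone (linear arithmetic; LP-found, `omega`). -/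
theorem liveBZ_gen1_of_live (a : Fin 8 → ℤ) (hc : Converges a) (hl : LiveBZ a) : LiveBZ (applyGen 1 a) := by
  rw [converges_iff] at hc; rw [liveBZ_iff] at hl
  simp only [applyGen_1, liveBZ_iff, genP01, Matrix.cons_val]
  omega

/-- Generator `2` preserves membership in the live cone `LiveBZ` on the live cone (linear arithmetic; LP-found, `omega`). -/
theorem liveBZ_gen2_of_live (a : Fin 8 → ℤ) (hc : Converges a) (hl : LiveBZ a) : LiveBZ (applyGen 2 a) := by
  rw [converges_iff] at hc; rw [liveBZ_iff] at hl
  simp only [applyGen_2, liveBZ_iff, genP12, Matrix.cons_val]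
  omega

/-- Generator `3` preserves membership in the live cone `LiveBZ` on the live cone (linear arithmetic; LP-found, `omega`). -/
theorem liveBZ_gen3_of_live (a : Fin 8 → ℤ) (hc : Converges a) (hl : LiveBZ a) : LiveBZ (applyGen 3 a) := by
  rw [converges_iff] at hc; rw [liveBZ_iff] at hl
  simp only [applyGen_3, liveBZ_iff, genH, Matrix.cons_val]
  omega

/-- Generator `4` preserves membership in the live cone `LiveBZ` on the live cone (linear arithmetic; LP-found, `omega`). -/
theorem liveBZ_gen4_of_live (a : Fin 8 → ℤ) (hc : Converges a) (hl : LiveBZ a) : LiveBZ (applyGen 4 a) := by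
  rw [converges_iff] at hc; rw [liveBZ_iff] at hl
  simp only [applyGen_4, liveBZ_iff, genH', Matrix.cons_val]
  omega

/-! ### All generators, all words -/

/-- A generator maps a live convergent vector to a convergent one. -/
theorem converges_applyGen_of_live (i : Fin 5) (a : Fin 8 → ℤ) (hc : Converges a) (hl : LiveBZ a) :
    Converges (applyGen i a) := by
  fin_cases i
  · exact converges_gen0_of_live a hc hl
  · exact converges_gen1_of_live a hc hl
  · exact converges_gen2_of_live a hc hl
  · exact converges_gen3_of_live a hc hl
  · exact converges_gen4_of_live a hc hl

/-- A generator maps a live convergent vector to a live one. -/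
theorem liveBZ_applyGen_of_live (i : Fin 5) (a : Fin 8 → ℤ) (hc : Converges a) (hl : LiveBZ a) :
    LiveBZ (applyGen i a) := by
  fin_cases i
  · exact liveBZ_gen0_of_live a hc hl
  · exact liveBZ_gen1_of_live a hc hl
  · exact liveBZ_gen2_of_live a hc hl
  · exact liveBZ_gen3_of_live a hc hl
  · exact liveBZ_gen4_of_live a hc hl

/-- **The live cone is `G`-stable and every word is a convergent chain on it.** -/
theorem live_chain (w : List (Fin 5)) : ∀ a : Fin 8 → ℤ, Converges a → LiveBZ a →
    ConvergentChain w a ∧ Converges (applyWord w a) ∧ LiveBZ (applyWord w a) := by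
  induction w with
  | nil =>
    intro a hc hl
    exact ⟨(convergentChain_nil a).2 hc, hc, hl⟩
  | cons i w ih =>
    intro a hc hl
    obtain ⟨h1, h2, h3⟩ := ih (applyGen i a) (converges_applyGen_of_live i a hc hl) (liveBZ_applyGen_of_live i a hc hl)
    exact ⟨(convergentChain_cons i w a).2 ⟨hc, h1⟩, h2, h3⟩

/-- Every word is a convergent chain from a live convergent vector. -/
theorem convergentChain_of_live (w : List (Fin 5)) (a : Fin 8 → ℤ) (hc : Converges a) (hl : LiveBZ a) :
    ConvergentChain w a := (live_chain w a hc hl).1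

/-- The orbit of a live convergent vector under words in the generators stays in the live cone. -/
theorem applyWord_live (w : List (Fin 5)) (a : Fin 8 → ℤ) (hc : Converges a) (hl : LiveBZ a) :
    Converges (applyWord w a) ∧ LiveBZ (applyWord w a) := (live_chain w a hc hl).2

/-- **(27) for the whole group on the live cone.**  Granted BZ's invariance per generator on common domains of convergence
(`invariance_of_converges'`, [BrownZudilin2022, (27)]), the normalised integral is invariant under every word — unconditionally in
the exponents, because every intermediate vector converges (`live_chain`). -/
theorem normalisedIntegral'_invariant_of_live (h27 : invariance_of_converges') (w : List (Fin 5)) (a : Fin 8 → ℤ)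
    (hc : Converges a) (hl : LiveBZ a) : normalisedIntegral' (applyWord w a) = normalisedIntegral' a :=
  normalisedIntegral'_chain h27 w a (convergentChain_of_live w a hc hl)

/-- The `X*`-representative produced by the cover (`xStarOrbitCover_holds`, p298540) is itself live and convergent. -/
theorem xStarOrbitCover_live (a : Fin 8 → ℤ) (hc : Converges a) (hl : LiveBZ a) :
    ∃ w : List (Fin 5), PolarWithinXStar (applyWord w a) ∧ Converges (applyWord w a) ∧ LiveBZ (applyWord w a) := by
  obtain ⟨w, _, hw⟩ := xStarOrbitCover_holds a hc hl
  exact ⟨w, hw, applyWord_live w a hc hl⟩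

end Summit.KontsevichZagierPeriods.Zeta5Search.Families.Cellular
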